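import Mathlib
import HarnessLib
import Summits.HubbardSuperconductivity.HubbardSuperconductivity.Theorems.ChiralWindowDefsResidual

/-!
# Certificate vocabulary, SECTOR ROW BOUNDS for the node covering (crux `CwKLChiralWindow`, route `ChiralWindow`, line `Sketch`)

Second companion of `Theorems/ChiralWindowDefs.lean` (record types) and `Theorems/ChiralWindowDefsResidual.lean` (residual-form
checker `KLCert.checkR`, enclosures `KLCert.EnclosuresR`); crux item stmt-HubbardSuperconductivity-1741.

The node-covering test bounds the pointwise remainder of a bottom state by `√R2 · ‖x - v‖`, where `R2` is a ROW BOUND of the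
kernel.  Interface E5 asked for the row bound of the BASE kernel, `sup_k ∫ χ₀(k+k')² dσ(k') ≈ 0.19`; but the remainder lives in the
symmetry sector, where the relevant kernel is the SECTOR kernel `K_χ(k,k') = (dim χ/8) Σ_g χ(g) κ(k, g·k')`, whose rows are smaller by
orders of magnitude (float census at `μ_b`, N = 64: `sup_k ∫ K_B1g(k,·)² dσ ≈ 1e-4`, `sup_k ∫ K_E(k,·)² dσ ≈ 7e-3`: the smooth
`D₄`-invariant bulk of `χ₀` projects to `A1g`).  With sector row bounds the Kato distance allowed by the node test grows by the same
factor and the node covering stops being the accuracy driver of the certificate (lead c4, `Cruxes/CwKLChiralWindow/CertInterface.md`).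

This file only NAMES the sector-row-bound node enclosures; the record type, the checker `KLCert.checkR` and all its rational
bookkeeping are UNCHANGED (the field `R2` of a box is simply read as a common bound for the two sector rows):
* `KLBox.NodeEnclosureS` — interface E5S + E6: for every `k` on the Fermi curve, `∫ K_B1g(k,k')² dσ(k') ≤ R2` and
  `∫ K_E(k,k')² dσ(k') ≤ R2` (sector kernels of the `B1g` and `E` blocks of the box), and the trial-amplitude disjunction of E6;
* `KLCert.EnclosuresRS` — the named numerical hypothesis: E0, and on every box, uniformly in `μ`, the residual-form block enclosures
  (`KLBlock.EnclosureR`) and `NodeEnclosureS`.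
Soundness (`checkR = true → EnclosuresRS → clauses N0–N5`) is proved in the companion Theorems files.
-/

noncomputable section

namespace Summit.HubbardSuperconductivity.HubbardSuperconductivity.Theorems.CwKLChiralWindow

set_option linter.dupNamespace false -- summit = problem name (single-conjunct summit), D-0017

open MeasureTheory Literature.MathematicalPhysics.QuantumLattice

namespace KLBox

/-- **The node-covering enclosures of a box with SECTOR row bounds** at the level `μ` (interface E5S, E6): for every `k` on the
Fermi curve, the rows of the `B1g` and `E` sector kernels of the box's blocks are square-integrable with `∫ K_χ(k,k')² dσ(k') ≤ R2`
(`χ = B1g, E`), and one of the trial amplitudes `F_B(k)², F_x(k)², F_y(k)²` clears its threshold (`F_Φ(k) = ∫ χ₀(k+k') Φ(k') dσ(k')`,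
`Φ_B, Φ_x` the `B1g`/`E` trials, `Φ_y = Φ_x ∘ rot³`). [folklore] -/
def NodeEnclosureS (bx : KLBox) (tab : List KLTrig) (μ : ℝ) : Prop :=
  ∀ k ∈ fermiCurve (squareDispersion 1 0) μ,
    ∫ k', bx.bB1g.sectorKernel μ D4Irrep.B1g k k' ^ 2 ∂fermiCurveMeasure (squareDispersion 1 0) μ ≤ (bx.R2 : ℝ) ∧
    ∫ k', bx.bE.sectorKernel μ D4Irrep.E k k' ^ 2 ∂fermiCurveMeasure (squareDispersion 1 0) μ ≤ (bx.R2 : ℝ) ∧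
    ((bx.pB : ℝ) ≤ (∫ k', lindhardFunction (squareDispersion 1 0) μ (k + k') * bx.bB1g.trialFun tab k'
        ∂fermiCurveMeasure (squareDispersion 1 0) μ) ^ 2 ∨
     (bx.pE : ℝ) ≤ (∫ k', lindhardFunction (squareDispersion 1 0) μ (k + k') * bx.bE.trialFun tab k'
        ∂fermiCurveMeasure (squareDispersion 1 0) μ) ^ 2 ∨
     (bx.pE : ℝ) ≤ (∫ k', lindhardFunction (squareDispersion 1 0) μ (k + k') *
        bx.bE.trialFun tab (rotMomentum (rotMomentum (rotMomentum k')))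
        ∂fermiCurveMeasure (squareDispersion 1 0) μ) ^ 2)

end KLBox

namespace KLCert

/-- **The named numerical hypothesis, residual form with sector row bounds (E0, E1, E2, E3R, E4, E5S, E6).** The fillings at the
two window ends, and on every box, uniformly in `μ`, the residual-form block enclosures of the five channels and the node-covering
enclosures with sector row bounds. [folklore] -/
def EnclosuresRS (c : KLCert) : Prop :=
  KohnLuttinger.filling (squareDispersion 1 0) (c.mua : ℝ) ≤ 7 / 10 ∧
    (13 / 25 : ℝ) ≤ KohnLuttinger.filling (squareDispersion 1 0) (c.mub : ℝ) ∧
    ∀ bx ∈ c.boxes, ∀ μ ∈ Set.Icc (bx.mulo : ℝ) (bx.muhi : ℝ),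
      (∀ χ : D4Irrep, (bx.blk χ).EnclosureR c.trials μ χ) ∧ bx.NodeEnclosureS c.trials μ

end KLCert

/-- The sector kernel of a block without the bare-`U` term is the `D₄`-projection of the Lindhard row. [folklore] -/
theorem klS_sectorKernel_eq : ∀ (b : KLBlock) (μ : ℝ) (χ : D4Irrep) (k k' : Momentum), b.withU = false →
    b.sectorKernel μ χ k k' = d4Project χ (fun q => lindhardFunction (squareDispersion 1 0) μ (k + q)) k' := by
  intro b μ χ k k' h
  simp [KLBlock.sectorKernel, KLBlock.baseKernel, h]

end Summit.HubbardSuperconductivity.HubbardSuperconductivity.Theorems.CwKLChiralWindow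

end
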